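import Mathlib
import Summits.CriticalPhenomena.CardyFormulaZ2.Theorems.CardySelfRefinementDefs
import Summits.CriticalPhenomena.CardyFormulaZ2.Theorems.CardySelfRefinementRussoDriftModel
import Summits.CriticalPhenomena.CardyFormulaZ2.Theorems.CardySelfRefinementTrivialSectorRateStubSixArmDecayCentres
import Literature.Probability.Percolation.FourArmGarbanShift
import Literature.Probability.Percolation.FourArmGarbanMonotone
import Literature.Probability.Percolation.FourArmGarbanDocking
import Literature.Probability.Percolation.SelfRefinementMeasure
import HarnessLib

/-!
# Helper (M4b), part 2, of stub `stub_fourArmAboveOne`, line `far-field-is-a-quarter-turn`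
(crux `TrivialSectorRate`, stmt-CriticalPhenomena-10266): RECENTRING the four-arm event at a
coarse vertex

The Garban scheme for the dependent model `M_k(ρ,c₀)` (files `…StubFourArmAboveOneExplorer*.lean`)
uses blocks ALIGNED with the coarse lattice `kℤ²`, so its separation step bounds the four-arm
probability `M_k(fourArmTwoClustersAt j h n₄)` around block centres `j ∈ kℤ²` only, whereas the
scheme data `hS` of `fourArmAboveOneAlong_of_garbanScheme` (and `FourArmAboveOneAlong`) quantify
over ALL centres `c ∈ ℤ²`; `M_k` is only `kℤ²`-translation invariant
(`M_real_fourArmTwoClustersAt_add_ctr`).  The missing step is elementary monotonicity of the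
cluster-form four-arm event under shrinking the annulus to a NON-CONCENTRIC smaller one (the
tree's `mem_fourArmTwoClusters_mono`, `FourArmGarbanMonotone.lean`, is the concentric case):

* `exists_openConnIn_sqAnnulus_of_near` — surgery: an open crossing of `w + A_{m,n}` contains an
  open crossing of the centred `A_{m',n'}` when `|w i| ≤ t`, `m + t < m' < n'`, `n' + t ≤ n`
  (last exit from `B(m'-1)`, then first visit to `‖·‖_∞ = n'`; `exists_prefix_exit`);
* `mem_fourArmTwoClusters_of_mem_fourArmTwoClustersAt_near` — hence
  `fourArmTwoClustersAt w m n ⊆ fourArmTwoClusters m' n'` on lattice configurations;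
* `M_real_fourArmTwoClustersAt_le_of_near` — `M_k(fourArmTwoClustersAt c m n) ≤
  M_k(fourArmTwoClustersAt c' m' n')` for `|c i - c' i| ≤ t` (lattice configurations carry `M_k`);
* `M_real_fourArmTwoClustersAt_le_ctr` (registered helper) — **for every centre `c` and every
  coarse vertex `u`, `M_k(fourArmTwoClustersAt c m n) ≤ M_k(fourArmTwoClustersAt (k•u) h n₄)`
  whenever `1 ≤ m`, `m + k < h < n₄`, `n₄ + k ≤ n`** (residue decomposition `c = c₀' + k v`,
  `kℤ²`-invariance, and the previous item with `t = k`).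

References: J. van den Berg, P. Nolin, Progr. Probab. 77 (2020), §2 (monotonicity of arm events
in the radii); O. Schramm, S. Smirnov (app. C. Garban), Ann. Probab. 39 (2011), App. B, proof of
Lemma B.1, first paragraph ("changing the radii by bounded factors").

Target file:
`Summits/CriticalPhenomena/CardyFormulaZ2/Theorems/CardySelfRefinementTrivialSectorRateStubFourArmAboveOneExplorerCentres.lean`.
-/

noncomputable section

namespace Summit.CriticalPhenomena.CardyFormulaZ2.Theorems.CardySelfRefinement.FarField

open Set MeasureTheory
open Literature.Probability.LatticeModels Literature.Probability.Percolation
open Literature.Probability.Percolation.QuadCrossing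
open Summit.CriticalPhenomena.CardyFormulaZ2.Theses.CardySelfRefinement

/-! ### Elementary geometry -/

/-- `{x ↔ y in S}` is monotone in the vertex set `S`. -/
theorem openConnIn_mono_set {V : Type*} {S S' : Set V} (h : S ⊆ S') {x y : V} {ω : BondConfig V}
    (hxy : ω ∈ openConnIn S x y) : ω ∈ openConnIn S' x y := by
  obtain ⟨hx, hy, hr⟩ := hxy
  exact ⟨h hx, h hy, hr.map (SimpleGraph.induceHomOfLE (G := openGraph ω) h).toHom⟩

/-- **A centred annulus inside an off-centre one**: if `|w i| ≤ t`, `1 ≤ m`, `m + t ≤ m'` and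
`n' + t ≤ n`, then `A_{m',n'} ⊆ w + A_{m,n}`. -/
theorem sqAnnulus_subset_image_add {w : Site 2} {t m n m' n' : ℕ} (hw : ∀ i, |w i| ≤ t)
    (hm : 1 ≤ m) (hmm' : m + t ≤ m') (hn'n : n' + t ≤ n) :
    sqAnnulus m' n' ⊆ (· + w) '' sqAnnulus m n := by
  intro v hv
  refine ⟨v - w, ?_, sub_add_cancel v w⟩
  simp only [sqAnnulus, Finset.mem_coe, mem_annulus, mem_box, not_forall] at hv ⊢
  obtain ⟨hvn, i₀, hi₀⟩ := hv
  refine ⟨fun i => ?_, ⟨i₀, fun h => hi₀ ?_⟩⟩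
  · have h1 := hvn i
    have h2 := hw i
    simp only [Pi.sub_apply]
    cases abs_cases (w i) <;> constructor <;> omega
  · have h2 := hw i₀
    simp only [Pi.sub_apply] at h
    cases abs_cases (w i₀) <;> constructor <;> omega

/-! ### Surgery: an off-centre open crossing contains a centred one -/

/-- **Surgery of an off-centre open crossing.**  On a lattice configuration, an open crossing of
`w + A_{m,n}` from `x` (`‖x - w‖_∞ = m`) to `y` (`‖y - w‖_∞ = n`) contains an open crossing of the
centred annulus `A_{m',n'}` from some `x'` with `‖x'‖_∞ = m'` to some `y'` with `‖y'‖_∞ = n'`,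
provided `|w i| ≤ t`, `m + t < m' < n'`, `n' + t ≤ n`; moreover `x'` lies on the original crossing,
so `x ↔ x'` in `w + A_{m,n}` (keep the part after the last visit to `B(m'-1)`, then stop at the
first visit to `‖·‖_∞ = n'`; van den Berg–Nolin 2020 §2, monotonicity of arm events, for
non-concentric annuli). -/
theorem exists_openConnIn_sqAnnulus_of_near {w : Site 2} {t m n m' n' : ℕ} (hw : ∀ i, |w i| ≤ t)
    (hmm' : m + t < m') (hm'n' : m' < n') (hn'n : n' + t ≤ n) {ω : BondConfig (Site 2)}
    (hω : ω ⊆ (zdGraph 2).edgeSet) {x y : Site 2} (hx : x - w ∈ siteSphere m)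
    (hy : y - w ∈ siteSphere n) (h : ω ∈ openConnIn ((· + w) '' sqAnnulus m n) x y) :
    ∃ x' ∈ siteSphere m', ∃ y' ∈ siteSphere n', ω ∈ openConnIn (sqAnnulus m' n') x' y' ∧
      ω ∈ openConnIn ((· + w) '' sqAnnulus m n) x x' := by
  classical
  obtain ⟨p, hps, hpe⟩ := exists_walk_of_mem_openConnIn hω h
  -- `x ∈ B(m'-1)` and `y ∉ B(n'-1)`
  have hxb : x ∈ box 2 (m' - 1) := by
    simp only [siteSphere, Finset.mem_sdiff, mem_box] at hx
    rw [mem_box]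
    intro i
    have h1 := hx.1 i
    have h2 := hw i
    simp only [Pi.sub_apply] at h1
    cases abs_cases (w i) <;> constructor <;> omega
  have hyb : y ∉ box 2 (n' - 1) := by
    intro hyb'
    have hn1 : 1 ≤ n := le_trans (by omega) hn'n
    obtain ⟨-, i, hi⟩ := (mem_siteSphere_iff hn1).1 hy
    have h1 := (mem_box.1 hyb') i
    have h2 := hw i
    simp only [Pi.sub_apply] at hi
    cases abs_cases (w i) <;> omega
  -- last entry into `B(m'-1)`: first exit of the reversed walk from the complement
  have hyA : y ∈ ({v | v ∉ box 2 (m' - 1)} : Set (Site 2)) := fun h' =>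
    hyb (box_mono 2 (by omega) h')
  have hxA : x ∉ ({v | v ∉ box 2 (m' - 1)} : Set (Site 2)) := fun h' => h' hxb
  obtain ⟨x', z', q₃, hx'z', hz', hA', hS', hE', -⟩ :=
    exists_prefix_exit (A := {v | v ∉ box 2 (m' - 1)}) p.reverse hyA hxA
  have hz'box : z' ∈ box 2 (m' - 1) := not_not.1 hz'
  have hx'a : x' ∈ box 2 m' := by
    have := mem_box_succ_of_adj hz'box hx'z'.symm
    rwa [Nat.sub_add_cancel (by omega : 1 ≤ m')] at this
  have hx's : x' ∈ siteSphere m' := Finset.mem_sdiff.2 ⟨hx'a, hA' x' q₃.end_mem_support⟩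
  have hx'p : x' ∈ p.support := by
    have := hS' x' q₃.end_mem_support
    rwa [SimpleGraph.Walk.support_reverse, List.mem_reverse] at this
  have hq₃e : ∀ e ∈ q₃.edges, e ∈ ω := fun e he => by
    have := hE' e he
    rw [SimpleGraph.Walk.edges_reverse, List.mem_reverse] at this
    exact hpe e this
  -- first exit from `B(n'-1)` along `q₃.reverse : x' → y`
  set q := q₃.reverse with hq
  have hx'B : x' ∈ (↑(box 2 (n' - 1)) : Set (Site 2)) := Finset.mem_coe.2 (box_mono 2 (by omega) hx'a)
  have hyB : y ∉ (↑(box 2 (n' - 1)) : Set (Site 2)) := fun h' => hyb (Finset.mem_coe.1 h')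
  obtain ⟨x'', z, q₁, hxz, hz, hB, hS, hE, hlast⟩ := exists_prefix_exit q hx'B hyB
  have hzb : z ∈ box 2 n' := by
    have := mem_box_succ_of_adj (Finset.mem_coe.1 (hB x'' q₁.end_mem_support)) hxz
    rwa [Nat.sub_add_cancel (by omega : 1 ≤ n')] at this
  have hzs : z ∈ siteSphere n' := Finset.mem_sdiff.2 ⟨hzb, fun h' => hz (Finset.mem_coe.2 h')⟩
  have hqsupp : ∀ v ∈ q.support, v ∉ box 2 (m' - 1) := fun v hv => by
    rw [hq, SimpleGraph.Walk.support_reverse, List.mem_reverse] at hv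
    exact hA' v hv
  have hqedge : ∀ e ∈ q.edges, e ∈ ω := fun e he => by
    rw [hq, SimpleGraph.Walk.edges_reverse, List.mem_reverse] at he
    exact hq₃e e he
  have hzq : z ∈ q.support := q.snd_mem_support_of_mem_edges hlast
  refine ⟨x', hx's, z, hzs, mem_openConnIn_of_walk (q₁.concat hxz) (fun v hv => ?_) (fun e he => ?_),
    mem_openConnIn_of_mem_support p hps hpe hx'p⟩
  · rw [SimpleGraph.Walk.support_concat, List.mem_append, List.mem_singleton] at hv
    simp only [sqAnnulus, Finset.mem_coe, mem_annulus]
    rcases hv with hv | rfl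
    · exact ⟨box_mono 2 (Nat.sub_le n' 1) (Finset.mem_coe.1 (hB v hv)), hqsupp v (hS v hv)⟩
    · exact ⟨hzb, hqsupp _ hzq⟩
  · rw [SimpleGraph.Walk.edges_concat, List.concat_eq_append, List.mem_append,
      List.mem_singleton] at he
    rcases he with he | rfl
    · exact hqedge e (hE e he)
    · exact hqedge _ hlast

/-- **Four arms around a nearby centre give four arms around the origin, in a smaller annulus**
(lattice configurations): if `|w i| ≤ t`, `1 ≤ m`, `m + t < m' < n'`, `n' + t ≤ n`, then
`fourArmTwoClustersAt w m n ⊆ fourArmTwoClusters m' n'` on `{ω ⊆ E(ℤ²)}` — the two crossings of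
`w + A_{m,n}` restrict to crossings of `A_{m',n'} ⊆ w + A_{m,n}` whose inner endpoints are not
joined in `A_{m',n'}` (a junction there, with the discarded initial pieces, would join `x₁` to
`x₂` in `w + A_{m,n}`). -/
theorem mem_fourArmTwoClusters_of_mem_fourArmTwoClustersAt_near {w : Site 2} {t m n m' n' : ℕ}
    (hw : ∀ i, |w i| ≤ t) (hm : 1 ≤ m) (hmm' : m + t < m') (hm'n' : m' < n') (hn'n : n' + t ≤ n)
    {ω : BondConfig (Site 2)} (hω : ω ⊆ (zdGraph 2).edgeSet) (h : ω ∈ fourArmTwoClustersAt w m n) :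
    ω ∈ fourArmTwoClusters m' n' := by
  obtain ⟨x₁, hx₁, x₂, hx₂, y₁, hy₁, y₂, hy₂, h₁, h₂, h₁₂⟩ := h
  obtain ⟨x₁', hx₁', y₁', hy₁', k₁, j₁⟩ := exists_openConnIn_sqAnnulus_of_near hw hmm' hm'n' hn'n hω hx₁ hy₁ h₁
  obtain ⟨x₂', hx₂', y₂', hy₂', k₂, j₂⟩ := exists_openConnIn_sqAnnulus_of_near hw hmm' hm'n' hn'n hω hx₂ hy₂ h₂
  refine ⟨x₁', hx₁', x₂', hx₂', y₁', hy₁', y₂', hy₂', k₁, k₂, fun hc => h₁₂ ?_⟩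
  have hc' : ω ∈ openConnIn ((· + w) '' sqAnnulus m n) x₁' x₂' :=
    openConnIn_mono_set (sqAnnulus_subset_image_add hw hm hmm'.le hn'n) hc
  rw [openConnIn_comm] at j₂
  exact PlanarDuality.openConnIn_trans (PlanarDuality.openConnIn_trans j₁ hc') j₂

/-! ### Recentring the four-arm probability under `M_k` -/

/-- **Moving the centre by at most `t` costs `t` on each radius**: for every law carried by
lattice configurations, in particular `M_k(ρ,c₀)`, and centres with `|c i - c' i| ≤ t`,
`M_k(fourArmTwoClustersAt c m n) ≤ M_k(fourArmTwoClustersAt c' m' n')` whenever `1 ≤ m`,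
`m + t < m' < n'`, `n' + t ≤ n` (translate by `-c'` and apply
`mem_fourArmTwoClusters_of_mem_fourArmTwoClustersAt_near`). -/
theorem M_real_fourArmTwoClustersAt_le_of_near (k : ℕ) (ρ c₀ : ℝ) {c c' : Site 2}
    {t m n m' n' : ℕ} (hcc' : ∀ i, |c i - c' i| ≤ t) (hm : 1 ≤ m) (hmm' : m + t < m')
    (hm'n' : m' < n') (hn'n : n' + t ≤ n) :
    (M k ρ c₀).real (fourArmTwoClustersAt c m n) ≤ (M k ρ c₀).real (fourArmTwoClustersAt c' m' n') := by
  haveI := isProbabilityMeasure_M k ρ c₀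
  refine ENNReal.toReal_mono (measure_ne_top _ _) (measure_mono_ae ?_)
  filter_upwards [selfRefinementMeasure_ae_subset_edgeSet k ρ c₀] with ω hω h4
  have h1 : BondConfig.relabel (sym2Equiv (Site.shift (-c'))) ω ∈ fourArmTwoClustersAt (c + -c') m n :=
    relabel_shift_mem_fourArmTwoClustersAt h4
  have hw : ∀ i, |(c + -c') i| ≤ t := fun i => by
    simp only [Pi.add_apply, Pi.neg_apply, ← sub_eq_add_neg]; exact hcc' i
  have h2 := mem_fourArmTwoClusters_of_mem_fourArmTwoClustersAt_near hw hm hmm' hm'n' hn'n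
    (relabel_shift_subset_edgeSet (-c') hω) h1
  show ω ∈ fourArmTwoClustersAt c' m' n'
  rw [fourArmTwoClustersAt_eq_preimage]
  exact h2

/-- **Recentring at a coarse vertex** (the input of the separation step of the Garban scheme for
`M_k`, whose blocks are centred on `kℤ²`): for every centre `c`, every coarse vertex `u` and radii
`1 ≤ m`, `m + k < h < n₄`, `n₄ + k ≤ n`,
`M_k(ρ,c₀)(fourArmTwoClustersAt c m n) ≤ M_k(ρ,c₀)(fourArmTwoClustersAt (k•u) h n₄)`:
write `c = c₀' + k v` with `c₀' ∈ [0,k)²` (`exists_eq_residue_add_ctr`), use the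
`kℤ²`-invariance of `M_k` (`M_real_fourArmTwoClustersAt_add_ctr`) to move `c` to `c₀'` and `k•u`
to `0`, and `M_real_fourArmTwoClustersAt_le_of_near` with `t = k` in between. -/
theorem M_real_fourArmTwoClustersAt_le_ctr {k : ℕ} (hk : 0 < k) (ρ c₀ : ℝ) (c u : Site 2)
    {m n h n₄ : ℕ} (hm : 1 ≤ m) (hh : m + k < h) (hhn : h < n₄) (hn : n₄ + k ≤ n) :
    (M k ρ c₀).real (fourArmTwoClustersAt c m n) ≤
      (M k ρ c₀).real (fourArmTwoClustersAt (ctr k u) h n₄) := by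
  have hk0 : k ≠ 0 := by omega
  obtain ⟨c₁, v, hc₁, rfl⟩ := exists_eq_residue_add_ctr hk c
  rw [M_real_fourArmTwoClustersAt_add_ctr hk0 ρ c₀ c₁ v m n,
    ← zero_add (ctr k u), M_real_fourArmTwoClustersAt_add_ctr hk0 ρ c₀ 0 u h n₄]
  refine M_real_fourArmTwoClustersAt_le_of_near k ρ c₀ (t := k) (fun i => ?_) hm hh hhn hn
  have := hc₁ i
  rw [Pi.zero_apply, sub_zero, abs_le]
  constructor <;> omega

end Summit.CriticalPhenomena.CardyFormulaZ2.Theorems.CardySelfRefinement.FarField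

end
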